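import Summits.ResolutionOfSingularities.ResolutionOfSingularities.Theorems.WildConesCampaignW46HypersurfacesCharTwoEmbDimDynamics
import Summits.ResolutionOfSingularities.ResolutionOfSingularities.Theorems.WildConesCampaignW46ThreefoldsCharTwoFamily

/-!
# [OURS · L1 W4.6, rung (ii) at p = 2, NON-VACUITY IN DIMENSION 5] The fivefold double point
# `z² = u₀u₁ + u₂u₃ + u₄⁵` is isolated with `e = 1` and has a double successor (`μ ≥ 4`) — the
# every-dimension regime `e ≤ 1` is inhabited beyond threefolds, over every field of characteristic 2

HONEST FRAMING. Everything here is OURS: an explicit computation in route WildCones' TYPED point-blow-up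
dynamics (`Theorems/WildConesClassicalRegimesDefs.lean`) in the pattern of the seat's gen-2 scope markers
(`…HypersurfacesCharTwo{Fourfold,Fivefold}NonClosure.lean`, p485483 / p484275), with the seat's invariant
`milnorEmbDim` (p498937). Purpose: the VACUITY check of the every-dimension OURS predicates
`CampaignW46HypersurfacesEmbDim…` (statement file, rev 2 p506168) beyond `n = 3` — an isolated double state with
`e = 1` AND a double successor exists in dimension `5`, so closure / uniqueness / existence / singular branch are
not vacuous there. NOTHING here is a statement of the manuscript [Hironaka2017]; no FACT-LIST premise; AI review
is weaker than expert review. Cell res-hironaka (LADDER-RESOLUTION rung L, D-0089), slot W4.6, seat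
res-L1-s46-pv-4 (gen 3); host route `WildCones`, crux `ClassicalRegimes` (stmt-ResolutionOfSingularities-16884;
proved).

WHAT IS PROVED (every field of characteristic `2`): start state `a = u₀u₁ + u₂u₃ + u₄⁵` — double point,
order-2 cleaned, ISOLATED (`(∂a) = (u₁,u₀,u₃,u₂,u₄⁴) ⊇ 𝔪⁴`); successor in chart `u₄` without translation
`u₀u₁ + u₂u₃ + u₄³` (`ser_step_of_ser_eq_fiveStart`), a double point, isolated (`(∂a') ⊇ 𝔪²`);
`fivefold_regime_witness` — `e(a) = 1` (odd, `≤ 3` by `OrdP`, `≠ 3` since the double successor is isolated,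
`hypersurface_not_isol_step_of_three_le`) and `μ(a) ≥ 4` (`hypersurface_four_le_mu_of_double_successor`).

References: res-L1-s46-pv-4 gen 2, p485483; G.-M. Greuel, G. Pfister, J. Algebra 689 (2026) [GreuelPfister2026]
(context); H. Hironaka, ms. 2017 [Hironaka2017] — nothing of it is used.
-/

noncomputable section

-- single-problem summit: the doubled namespace component `ResolutionOfSingularities` is forced
set_option linter.dupNamespace false

open scoped BigOperators Classical

open MvPowerSeries IsLocalRing

open Literature.AlgebraicGeometry.Resolution

namespace Summit.ResolutionOfSingularities.ResolutionOfSingularities.Theorems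

namespace CampaignW46.HypersurfacesCharTwo

open WildCones WildCones.MuDropCharTwoOrdP ThreefoldsCharTwo

variable {κ : Type} [Field κ]

/-! ## The start state `u₀u₁ + u₂u₃ + u₄⁵` in five variables -/

/-- Coefficients of `X₀X₁ + X₂X₃ + X₄⁵`. [folklore] -/
theorem coeff_fiveStart (A : Fin 5 →₀ ℕ) :
    coeff A ((X 0 * X 1 + X 2 * X 3 + X 4 ^ 5 : MvPowerSeries (Fin 5) κ)) =
      (if A = Finsupp.single 0 1 + Finsupp.single 1 1 then 1 else 0) +
        (if A = Finsupp.single 2 1 + Finsupp.single 3 1 then 1 else 0) +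
        (if A = Finsupp.single 4 5 then 1 else 0) := by
  rw [map_add, map_add, X_pow_eq, X_def, X_def, X_def, X_def, monomial_mul_monomial,
    monomial_mul_monomial, one_mul, coeff_monomial, coeff_monomial, coeff_monomial]

/-- The start series has no monomial with all exponents even. [folklore] -/
theorem fiveStart_coeff_eq_zero_of_even (A : Fin 5 →₀ ℕ) (hA : ∀ j, 2 ∣ A j) :
    coeff A ((X 0 * X 1 + X 2 * X 3 + X 4 ^ 5 : MvPowerSeries (Fin 5) κ)) = 0 := by
  rw [coeff_fiveStart]
  have h0 : A ≠ Finsupp.single 0 1 + Finsupp.single 1 1 := by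
    rintro rfl; have := hA 0; simp at this
  have h1 : A ≠ Finsupp.single 2 1 + Finsupp.single 3 1 := by
    rintro rfl; have := hA 2; simp at this
  have h2 : A ≠ Finsupp.single 4 5 := by
    rintro rfl; have := hA 4; rw [Finsupp.single_eq_same] at this; omega
  rw [if_neg h0, if_neg h1, if_neg h2]
  simp

/-- The pair coefficient `[X₀X₁]` of the start series is `1`. [folklore] -/
theorem coeff_pair_fiveStart :
    coeff (Finsupp.single 0 1 + Finsupp.single 1 1)
      ((X 0 * X 1 + X 2 * X 3 + X 4 ^ 5 : MvPowerSeries (Fin 5) κ)) = 1 := by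
  rw [coeff_fiveStart, if_pos rfl]
  have h1 : (Finsupp.single 0 1 + Finsupp.single 1 1 : Fin 5 →₀ ℕ) ≠
      Finsupp.single 2 1 + Finsupp.single 3 1 := by
    intro h'; have := DFunLike.congr_fun h' 0; simp at this
  have h2 : (Finsupp.single 0 1 + Finsupp.single 1 1 : Fin 5 →₀ ℕ) ≠ Finsupp.single 4 5 := by
    intro h'; have := DFunLike.congr_fun h' 0; simp at this
  rw [if_neg h1, if_neg h2]
  simp

/-- [OURS · L1 W4.6] A state (`n = 5`) with cleaned series `u₀u₁ + u₂u₃ + u₄⁵` is a double point. [folklore] -/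
theorem multP_of_ser_eq_fiveStart {c : (Fin 5 → ℕ) → κ}
    (hc : ser 2 5 κ c = X 0 * X 1 + X 2 * X 3 + X 4 ^ 5) : MultP 2 5 κ c := by
  rw [multP_iff_ser, hc]
  constructor
  · intro h
    have h1 := congrArg (coeff (Finsupp.single (0 : Fin 5) 1 + Finsupp.single 1 1)) h
    rw [coeff_pair_fiveStart, map_zero] at h1
    exact one_ne_zero h1
  · refine nat_le_order fun d hd => ?_
    rw [coeff_fiveStart]
    have h0 : d ≠ Finsupp.single 0 1 + Finsupp.single 1 1 := by
      rintro rfl; simp only [map_add, Finsupp.degree_single] at hd; omega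
    have h1 : d ≠ Finsupp.single 2 1 + Finsupp.single 3 1 := by
      rintro rfl; simp only [map_add, Finsupp.degree_single] at hd; omega
    have h2 : d ≠ Finsupp.single 4 5 := by
      rintro rfl; rw [Finsupp.degree_single] at hd; omega
    rw [if_neg h0, if_neg h1, if_neg h2]
    simp

/-- [OURS · L1 W4.6] … and order-2 cleaned (`u₀u₁`). [folklore] -/
theorem ordP_of_ser_eq_fiveStart {c : (Fin 5 → ℕ) → κ}
    (hc : ser 2 5 κ c = X 0 * X 1 + X 2 * X 3 + X 4 ^ 5) : OrdP 2 5 κ c := by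
  rw [ordP_two_iff_exists_pair, hc]
  exact ⟨0, 1, by decide, by rw [coeff_pair_fiveStart]; exact one_ne_zero⟩

/-- In characteristic two: `∂₀ a = X₁`, `∂₁ a = X₀`, `∂₂ a = X₃`, `∂₃ a = X₂`, `∂₄ a = X₄⁴` (`5 = 1`).
[folklore] -/
theorem pderiv_fiveStart [CharP κ 2] (s : Fin 5) :
    MvPowerSeries.pderiv s ((X 0 * X 1 + X 2 * X 3 + X 4 ^ 5 : MvPowerSeries (Fin 5) κ)) =
      if s = 0 then X 1 else if s = 1 then X 0 else if s = 2 then X 3 else if s = 3 then X 2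
        else X 4 ^ 4 := by
  have h5 : (5 : MvPowerSeries (Fin 5) κ) = 1 := by
    rw [show (5 : MvPowerSeries (Fin 5) κ) = 2 * 2 + 1 by norm_num, ← map_ofNat (C : κ →+* _) 2,
      CharTwo.two_eq_zero, map_zero, mul_zero, zero_add]
  rw [map_add, map_add, Derivation.leibniz, Derivation.leibniz, Derivation.leibniz_pow,
    MvPowerSeries.pderiv_X, MvPowerSeries.pderiv_X, MvPowerSeries.pderiv_X, MvPowerSeries.pderiv_X,
    MvPowerSeries.pderiv_X]
  fin_cases s <;> simp [smul_eq_mul, h5]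

/-- `𝔪⁴ ≤ (∂a)` for the start series: a monomial of degree `4` in five variables is divisible by one of
`X₀, X₁, X₂, X₃` or equals `X₄⁴`. [folklore] -/
theorem maximalIdeal_pow_four_le_jac_fiveStart [CharP κ 2] :
    maximalIdeal (MvPowerSeries (Fin 5) κ) ^ 4 ≤
      Ideal.span (Set.range fun s : Fin 5 =>
        MvPowerSeries.pderiv s ((X 0 * X 1 + X 2 * X 3 + X 4 ^ 5 : MvPowerSeries (Fin 5) κ))) := by
  rw [Literature.RingTheory.MvPowerSeries.Jets.maximalIdeal_pow_eq_span_monomial, Ideal.span_le]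
  rintro _ ⟨e, he, rfl⟩
  change e.degree = 4 at he
  change (monomial e (1 : κ) : MvPowerSeries (Fin 5) κ) ∈ _
  have mem_of : ∀ (s : Fin 5) (k : ℕ), k ≤ e s →
      (∃ s', (X s : MvPowerSeries (Fin 5) κ) ^ k = MvPowerSeries.pderiv s'
        ((X 0 * X 1 + X 2 * X 3 + X 4 ^ 5 : MvPowerSeries (Fin 5) κ))) →
      (monomial e (1 : κ) : MvPowerSeries (Fin 5) κ) ∈ Ideal.span (Set.range fun s : Fin 5 =>
        MvPowerSeries.pderiv s ((X 0 * X 1 + X 2 * X 3 + X 4 ^ 5 : MvPowerSeries (Fin 5) κ))) := by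
    rintro s k hk ⟨s', h⟩
    have hdec : (monomial e (1 : κ) : MvPowerSeries (Fin 5) κ) =
        monomial (e - Finsupp.single s k) (1 : κ) * X s ^ k := by
      rw [X_pow_eq, monomial_mul_monomial, one_mul, tsub_add_cancel_of_le]
      intro t
      by_cases hts : t = s
      · subst hts; rwa [Finsupp.single_eq_same]
      · rw [Finsupp.single_apply, if_neg (Ne.symm hts)]; exact Nat.zero_le _
    rw [hdec]
    exact Ideal.mul_mem_left _ _ (Ideal.subset_span ⟨s', h.symm⟩)
  by_cases h0 : 1 ≤ e 0
  · exact mem_of 0 1 h0 ⟨1, by rw [pderiv_fiveStart]; simp⟩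
  by_cases h1 : 1 ≤ e 1
  · exact mem_of 1 1 h1 ⟨0, by rw [pderiv_fiveStart]; simp⟩
  by_cases h2 : 1 ≤ e 2
  · exact mem_of 2 1 h2 ⟨3, by rw [pderiv_fiveStart]; simp⟩
  by_cases h3 : 1 ≤ e 3
  · exact mem_of 3 1 h3 ⟨2, by rw [pderiv_fiveStart]; simp⟩
  have hsum : e.degree = e 0 + e 1 + e 2 + e 3 + e 4 := by
    rw [degree_eq_sum_univ, Fin.sum_univ_five]
  have h4 : 4 ≤ e 4 := by omega
  exact mem_of 4 4 h4 ⟨4, by rw [pderiv_fiveStart]; simp⟩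

/-- [OURS · L1 W4.6] **The start state is ISOLATED**: `(∂a) ⊇ 𝔪⁴`. [folklore] -/
theorem isol_of_ser_eq_fiveStart [CharP κ 2] {c : (Fin 5 → ℕ) → κ}
    (hc : ser 2 5 κ c = X 0 * X 1 + X 2 * X 3 + X 4 ^ 5) : Isol 2 5 κ c := by
  rw [isol_iff_finite_pderiv, hc]
  haveI := Literature.RingTheory.MvPowerSeries.Jets.finite_quotient_maximalIdeal_pow
    (σ := Fin 5) (K := κ) 4
  exact Module.Finite.of_surjective
    (Ideal.Quotient.factorₐ κ maximalIdeal_pow_four_le_jac_fiveStart).toLinearMap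
    (Ideal.Quotient.factor_surjective maximalIdeal_pow_four_le_jac_fiveStart)

/-! ## One step: chart `u₄`, no translation -/

/-- The blow-up substitution `Φ_{4,0}` on the start series: `a∘Φ = X₄² · (X₀X₁ + X₂X₃ + X₄³)`. [folklore] -/
theorem subst_blowFam_fiveStart :
    subst (fun s => if s = (4 : Fin 5) then (X 4 : MvPowerSeries (Fin 5) κ)
        else X 4 * (X s + C ((0 : Fin 5 → κ) s)))
        ((X 0 * X 1 + X 2 * X 3 + X 4 ^ 5 : MvPowerSeries (Fin 5) κ)) =
      X 4 ^ 2 * (X 0 * X 1 + X 2 * X 3 + X 4 ^ 3) := by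
  have ha := hasSubst_blowFam (κ := κ) (4 : Fin 5) (0 : Fin 5 → κ)
  rw [subst_add ha, subst_add ha, subst_mul ha, subst_mul ha, subst_pow ha, subst_X ha, subst_X ha,
    subst_X ha, subst_X ha, subst_X ha]
  rw [if_neg (show (0 : Fin 5) ≠ 4 by decide), if_neg (show (1 : Fin 5) ≠ 4 by decide),
    if_neg (show (2 : Fin 5) ≠ 4 by decide), if_neg (show (3 : Fin 5) ≠ 4 by decide), if_pos rfl]
  simp only [Pi.zero_apply, map_zero, add_zero]
  ring

/-- Coefficients of the successor series `X₀X₁ + X₂X₃ + X₄³`. [folklore] -/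
theorem coeff_fiveStep (A : Fin 5 →₀ ℕ) :
    coeff A ((X 0 * X 1 + X 2 * X 3 + X 4 ^ 3 : MvPowerSeries (Fin 5) κ)) =
      (if A = Finsupp.single 0 1 + Finsupp.single 1 1 then 1 else 0) +
        (if A = Finsupp.single 2 1 + Finsupp.single 3 1 then 1 else 0) +
        (if A = Finsupp.single 4 3 then 1 else 0) := by
  rw [map_add, map_add, X_pow_eq, X_def, X_def, X_def, X_def, monomial_mul_monomial,
    monomial_mul_monomial, one_mul, coeff_monomial, coeff_monomial, coeff_monomial]

/-- The successor series has no monomial with all exponents even. [folklore] -/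
theorem fiveStep_coeff_eq_zero_of_even (A : Fin 5 →₀ ℕ) (hA : ∀ j, 2 ∣ A j) :
    coeff A ((X 0 * X 1 + X 2 * X 3 + X 4 ^ 3 : MvPowerSeries (Fin 5) κ)) = 0 := by
  rw [coeff_fiveStep]
  have h0 : A ≠ Finsupp.single 0 1 + Finsupp.single 1 1 := by
    rintro rfl; have := hA 0; simp at this
  have h1 : A ≠ Finsupp.single 2 1 + Finsupp.single 3 1 := by
    rintro rfl; have := hA 2; simp at this
  have h2 : A ≠ Finsupp.single 4 3 := by
    rintro rfl; have := hA 4; rw [Finsupp.single_eq_same] at this; omega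
  rw [if_neg h0, if_neg h1, if_neg h2]
  simp

/-- The pair coefficient `[X₀X₁]` of the successor series is `1`. [folklore] -/
theorem coeff_pair_fiveStep :
    coeff (Finsupp.single 0 1 + Finsupp.single 1 1)
      ((X 0 * X 1 + X 2 * X 3 + X 4 ^ 3 : MvPowerSeries (Fin 5) κ)) = 1 := by
  rw [coeff_fiveStep, if_pos rfl]
  have h1 : (Finsupp.single 0 1 + Finsupp.single 1 1 : Fin 5 →₀ ℕ) ≠
      Finsupp.single 2 1 + Finsupp.single 3 1 := by
    intro h'; have := DFunLike.congr_fun h' 0; simp at this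
  have h2 : (Finsupp.single 0 1 + Finsupp.single 1 1 : Fin 5 →₀ ℕ) ≠ Finsupp.single 4 3 := by
    intro h'; have := DFunLike.congr_fun h' 0; simp at this
  rw [if_neg h1, if_neg h2]
  simp

/-- [OURS · L1 W4.6] **The step on the start state**: the successor in chart `u₄` without translation has
cleaned series `u₀u₁ + u₂u₃ + u₄³`. [folklore] -/
theorem ser_step_of_ser_eq_fiveStart [CharP κ 2] {c : (Fin 5 → ℕ) → κ}
    (hc : ser 2 5 κ c = X 0 * X 1 + X 2 * X 3 + X 4 ^ 5) :
    ser 2 5 κ (step 2 5 κ 4 0 c) = X 0 * X 1 + X 2 * X 3 + X 4 ^ 3 := by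
  have hM : MultP 2 5 κ c := multP_of_ser_eq_fiveStart hc
  have key := X_pow_mul_serT_eq_subst c 4 0 hM
  rw [hc, subst_blowFam_fiveStart] at key
  have hX4 : (X 4 : MvPowerSeries (Fin 5) κ) ≠ 0 := fun h => by
    have h1 := congrArg (coeff (Finsupp.single (4 : Fin 5) 1)) h
    rw [coeff_index_single_self_X, map_zero] at h1
    exact one_ne_zero h1
  have hT := mul_left_cancel₀ (pow_ne_zero 2 hX4) key
  ext A
  rw [coeff_ser_step c 4 0 hM A]
  have hTA : tr 5 κ 4 0 2 (dv 5 κ 4 2 (bl 5 κ 4 (clean 2 5 κ c))) ⇑A =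
      coeff A ((X 0 * X 1 + X 2 * X 3 + X 4 ^ 3 : MvPowerSeries (Fin 5) κ)) := by
    rw [← hT]; rfl
  have clean_apply : ∀ (g : (Fin 5 → ℕ) → κ) (B : Fin 5 → ℕ),
      clean 2 5 κ g B = @ite κ (∀ j, 2 ∣ B j) (Classical.dec _) 0 (g B) := fun _ _ => rfl
  rw [clean_apply]
  by_cases h : ∀ j, 2 ∣ (⇑A) j
  · rw [if_pos h, fiveStep_coeff_eq_zero_of_even A h]
  · rw [if_neg h, hTA]

/-- [OURS · L1 W4.6] The successor is a DOUBLE POINT. [folklore] -/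
theorem multP_step_fiveStart [CharP κ 2] {c : (Fin 5 → ℕ) → κ}
    (hc : ser 2 5 κ c = X 0 * X 1 + X 2 * X 3 + X 4 ^ 5) : MultP 2 5 κ (step 2 5 κ 4 0 c) := by
  rw [multP_iff_ser, ser_step_of_ser_eq_fiveStart hc]
  constructor
  · intro h
    have h1 := congrArg (coeff (Finsupp.single (0 : Fin 5) 1 + Finsupp.single 1 1)) h
    rw [coeff_pair_fiveStep, map_zero] at h1
    exact one_ne_zero h1
  · refine nat_le_order fun d hd => ?_
    rw [coeff_fiveStep]
    have h0 : d ≠ Finsupp.single 0 1 + Finsupp.single 1 1 := by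
      rintro rfl; simp only [map_add, Finsupp.degree_single] at hd; omega
    have h1 : d ≠ Finsupp.single 2 1 + Finsupp.single 3 1 := by
      rintro rfl; simp only [map_add, Finsupp.degree_single] at hd; omega
    have h2 : d ≠ Finsupp.single 4 3 := by
      rintro rfl; rw [Finsupp.degree_single] at hd; omega
    rw [if_neg h0, if_neg h1, if_neg h2]
    simp

/-- In characteristic two: `∂₀ a' = X₁`, `∂₁ a' = X₀`, `∂₂ a' = X₃`, `∂₃ a' = X₂`, `∂₄ a' = X₄²` (`3 = 1`) for
the successor series. [folklore] -/
theorem pderiv_fiveStep [CharP κ 2] (s : Fin 5) :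
    MvPowerSeries.pderiv s ((X 0 * X 1 + X 2 * X 3 + X 4 ^ 3 : MvPowerSeries (Fin 5) κ)) =
      if s = 0 then X 1 else if s = 1 then X 0 else if s = 2 then X 3 else if s = 3 then X 2
        else X 4 ^ 2 := by
  have h3 : (3 : MvPowerSeries (Fin 5) κ) = 1 := by
    rw [show (3 : MvPowerSeries (Fin 5) κ) = 2 + 1 by norm_num, ← map_ofNat (C : κ →+* _) 2,
      CharTwo.two_eq_zero, map_zero, zero_add]
  rw [map_add, map_add, Derivation.leibniz, Derivation.leibniz, Derivation.leibniz_pow,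
    MvPowerSeries.pderiv_X, MvPowerSeries.pderiv_X, MvPowerSeries.pderiv_X, MvPowerSeries.pderiv_X,
    MvPowerSeries.pderiv_X]
  fin_cases s <;> simp [smul_eq_mul, h3]

/-- `𝔪² ≤ (∂a')` for the successor series. [folklore] -/
theorem maximalIdeal_pow_two_le_jac_fiveStep [CharP κ 2] :
    maximalIdeal (MvPowerSeries (Fin 5) κ) ^ 2 ≤
      Ideal.span (Set.range fun s : Fin 5 =>
        MvPowerSeries.pderiv s ((X 0 * X 1 + X 2 * X 3 + X 4 ^ 3 : MvPowerSeries (Fin 5) κ))) := by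
  rw [Literature.RingTheory.MvPowerSeries.Jets.maximalIdeal_pow_eq_span_monomial, Ideal.span_le]
  rintro _ ⟨e, he, rfl⟩
  change e.degree = 2 at he
  change (monomial e (1 : κ) : MvPowerSeries (Fin 5) κ) ∈ _
  have mem_of : ∀ (s : Fin 5) (k : ℕ), k ≤ e s →
      (∃ s', (X s : MvPowerSeries (Fin 5) κ) ^ k = MvPowerSeries.pderiv s'
        ((X 0 * X 1 + X 2 * X 3 + X 4 ^ 3 : MvPowerSeries (Fin 5) κ))) →
      (monomial e (1 : κ) : MvPowerSeries (Fin 5) κ) ∈ Ideal.span (Set.range fun s : Fin 5 =>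
        MvPowerSeries.pderiv s ((X 0 * X 1 + X 2 * X 3 + X 4 ^ 3 : MvPowerSeries (Fin 5) κ))) := by
    rintro s k hk ⟨s', h⟩
    have hdec : (monomial e (1 : κ) : MvPowerSeries (Fin 5) κ) =
        monomial (e - Finsupp.single s k) (1 : κ) * X s ^ k := by
      rw [X_pow_eq, monomial_mul_monomial, one_mul, tsub_add_cancel_of_le]
      intro t
      by_cases hts : t = s
      · subst hts; rwa [Finsupp.single_eq_same]
      · rw [Finsupp.single_apply, if_neg (Ne.symm hts)]; exact Nat.zero_le _
    rw [hdec]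
    exact Ideal.mul_mem_left _ _ (Ideal.subset_span ⟨s', h.symm⟩)
  by_cases h0 : 1 ≤ e 0
  · exact mem_of 0 1 h0 ⟨1, by rw [pderiv_fiveStep]; simp⟩
  by_cases h1 : 1 ≤ e 1
  · exact mem_of 1 1 h1 ⟨0, by rw [pderiv_fiveStep]; simp⟩
  by_cases h2 : 1 ≤ e 2
  · exact mem_of 2 1 h2 ⟨3, by rw [pderiv_fiveStep]; simp⟩
  by_cases h3 : 1 ≤ e 3
  · exact mem_of 3 1 h3 ⟨2, by rw [pderiv_fiveStep]; simp⟩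
  have hsum : e.degree = e 0 + e 1 + e 2 + e 3 + e 4 := by
    rw [degree_eq_sum_univ, Fin.sum_univ_five]
  have h4 : 2 ≤ e 4 := by omega
  exact mem_of 4 2 h4 ⟨4, by rw [pderiv_fiveStep]; simp⟩

/-- [OURS · L1 W4.6] **The successor is ISOLATED**: `(∂a') ⊇ 𝔪²`. [folklore] -/
theorem isol_step_fiveStart [CharP κ 2] {c : (Fin 5 → ℕ) → κ}
    (hc : ser 2 5 κ c = X 0 * X 1 + X 2 * X 3 + X 4 ^ 5) : Isol 2 5 κ (step 2 5 κ 4 0 c) := by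
  rw [isol_iff_finite_pderiv, ser_step_of_ser_eq_fiveStart hc]
  haveI := Literature.RingTheory.MvPowerSeries.Jets.finite_quotient_maximalIdeal_pow
    (σ := Fin 5) (K := κ) 2
  exact Module.Finite.of_surjective
    (Ideal.Quotient.factorₐ κ maximalIdeal_pow_two_le_jac_fiveStep).toLinearMap
    (Ideal.Quotient.factor_surjective maximalIdeal_pow_two_le_jac_fiveStep)

/-! ## The witness: the regime `e = 1` is inhabited in dimension five, with a double successor -/

/-- [OURS · L1 W4.6 rung (ii) at `p = 2`, NON-VACUITY WITNESS in dimension `5`; NOT a statement of the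
manuscript] Over EVERY field of characteristic `2` the fivefold double point `z² = u₀u₁ + u₂u₃ + u₄⁵` is an
ISOLATED double point with Milnor algebra of embedding dimension EXACTLY `1` (polar form of corank one)
whose point-blow-up successor in chart `u₄` (no translation) is again a double point (hence, by the regime
theorems, isolated with `e = 1` and `μ − 2`; here directly `(∂a') ⊇ 𝔪²`), and `μ ≥ 4`: the hypotheses of the
every-dimension regime predicates `CampaignW46HypersurfacesEmbDim…` are simultaneously satisfiable beyond
`n = 3`. (`e = 1`: `e` is odd, `≤ 3` by `OrdP`, and `e = 3` would make the double successor non-isolated,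
`hypersurface_not_isol_step_of_three_le`.) [folklore] -/
theorem fivefold_regime_witness (κ : Type) [Field κ] [CharP κ 2] :
    ∃ c : (Fin 5 → ℕ) → κ, MultP 2 5 κ c ∧ Isol 2 5 κ c ∧ milnorEmbDim 2 5 κ c = 1 ∧
      MultP 2 5 κ (step 2 5 κ 4 0 c) ∧ Isol 2 5 κ (step 2 5 κ 4 0 c) ∧ 4 ≤ mu 2 5 κ c := by
  obtain ⟨c, hc⟩ := exists_ser_eq (κ := κ)
    ((X 0 * X 1 + X 2 * X 3 + X 4 ^ 5 : MvPowerSeries (Fin 5) κ)) fiveStart_coeff_eq_zero_of_even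
  have hM := multP_of_ser_eq_fiveStart hc
  have hO := ordP_of_ser_eq_fiveStart hc
  have hI := isol_of_ser_eq_fiveStart hc
  have hM' := multP_step_fiveStart hc
  have hI' := isol_step_fiveStart hc
  have he : milnorEmbDim 2 5 κ c = 1 := by
    have h1 := (ordP_iff_milnorEmbDim_add_two_le hM).mp hO
    have h2 := (milnorEmbDim_le_and_mod_two hM).2.1
    have h3 : ¬ 3 ≤ milnorEmbDim 2 5 κ c := fun h =>
      hypersurface_not_isol_step_of_three_le c 4 0 hM h hM' hI'
    omega
  exact ⟨c, hM, hI, he, hM', hI',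
    (hypersurface_four_le_mu_of_double_successor c 4 0 hM hI (by omega) hM').2.2⟩

end CampaignW46.HypersurfacesCharTwo

end Summit.ResolutionOfSingularities.ResolutionOfSingularities.Theorems

end
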